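import Summits.Langlands.Langlands.Theses.SkinnerWilesDefectOne
import Literature.NumberTheory.Automorphic.OrdinaryCompletedCohomologyGL
import Literature.NumberTheory.GaloisRepresentations.HeckeCharacter

set_option linter.dupNamespace false

noncomputable section

/-!
# Birth skeleton (BC3) of the split child `OrdinaryFactorisationIwahoriNonCM` (X₁, crux) of
# `ProModularOrdinaryClassical` (stmt-Langlands-12921), route SkinnerWilesDefectOne

Three registered-shape stubs — the three logically separate steps lead c3 isolated inside the open core (OPEN-CORE-c3 §1:
(S1) tower change, (S2) Galois-ordinary ⇒ slope `0`, (S3) the ordering bit) — and the kernel-checked composition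
`OrdinaryFactorisationIwahoriNonCM_of`.  `X₁` is stated UNFOLDED (the child's one-line Prop; this file predates the route edit).
-/

namespace Summit.Langlands.Langlands.Cruxes.OrdinaryFactorisationIwahoriNonCM.Birth

open Summit.Langlands.Langlands.Theses.SkinnerWilesDefectOne
open Literature.NumberTheory.Automorphic Literature.NumberTheory.GaloisRepresentations
open Literature.NumberTheory.Automorphic.BigHeckeGLn
open NumberField IsDedekindDomain Filter

/-- **Stub (S1) — tower change** (INFRASTRUCTURE, true in nature, not provable from the tree's definitions — OPEN-CORE-c3 §2:
needs Gee–Newton DERIVED big Hecke algebras or the Noetherian/bounded-degree package; STRATEGY-CENSUS §6 R3 definition request):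
a `ρ` associated with a continuous `ℚ̄_p`-point of the completed-cohomology Hecke algebra of the PRINCIPAL `p`-power tower at some
tame level is associated with a continuous point of the HIDA-tower algebra `𝕋^S(𝒰; p)` at a tame level `𝒰` maximal above `p`
(`IsIwahoriPadicallyAutomorphic`: any refinement, no slope condition). Size: L (definition-level). -/
theorem stub_towerChange :
    ∀ (F : Type) [Field F] [NumberField F] (p : ℕ) [Fact p.Prime] (ρ : Literature.NumberTheory.GaloisRepresentations.FramedGaloisRep F (PadicAlgCl p) 2), (∃ 𝒰 : Literature.NumberTheory.Automorphic.BigHeckeGLn.TameLevel 2 F p, 𝒰.IsPadicallyAutomorphic ρ) → ∃ 𝒰 : Literature.NumberTheory.Automorphic.BigHeckeGLn.TameLevel 2 F p, 𝒰.IsMaximalAbove ∧ 𝒰.IsIwahoriPadicallyAutomorphic ρ := by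
  sorry

/-- **Stub (S2) — slope-zero refinement** (THE OPEN MATHEMATICS: Galois-ordinary ⇒ Hecke-ordinary; Hansen 2017 Conj. 1.2.3 /
Khare–Thorne 2017 Conj. 6.18 at slope `0`; Emerton 2011 Thm. 1.2.1 over `ℚ` only): for NON-CM irreducible `ρ`, Iwahori-pro-modular at
a level maximal above `p` and Galois-ordinary of parallel weight `k ≥ 2` (`m > 0`), SOME continuous point of a Hida-tower algebra at a
level maximal above `p` associated with `ρ` has slope zero at every `v ∣ p`. Honours `Disproof.lean` §0 (`crux_of_ordinaryFontaineMazur`: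
the only hypothesis distinguishing the crux from FM(B) is pro-modularity — used HERE). Size: XL / open problem. -/
theorem stub_slopeZeroRefinement :
    ∀ (F : Type) [Field F] [NumberField F], NumberField.IsTotallyComplex F → Module.finrank ℚ F = 2 → ∀ (p : ℕ) [Fact p.Prime], p ≠ 2 → ∀ (ι : PadicAlgCl p ≃+* ℂ) (ρ : Literature.NumberTheory.GaloisRepresentations.FramedGaloisRep F (PadicAlgCl p) 2) (k m : ℕ), ρ.toGaloisRep.IsIrreducible → (¬ ∃ (K : Type) (_ : Field K) (_ : NumberField K) (_ : Algebra F K) (_ : Module.finrank F K = 2) (θ : Literature.NumberTheory.GaloisRepresentations.HeckeCharacter K), θ.IsAlgebraic ∧ (∃ᶠ w : IsDedekindDomain.HeightOneSpectrum (NumberField.RingOfIntegers K) in Filter.cofinite, ∃ w' : IsDedekindDomain.HeightOneSpectrum (NumberField.RingOfIntegers K), w'.asIdeal.under (NumberField.RingOfIntegers F) = w.asIdeal.under (NumberField.RingOfIntegers F) ∧ θ.valueAtUniformizer w' ≠ θ.valueAtUniformizer w) ∧ ∀ᶠ v : IsDedekindDomain.HeightOneSpectrum (NumberField.RingOfIntegers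 F) in Filter.cofinite, ρ.IsUnramifiedAt v ∧ ρ.HasFrobCharpolyAt v (∏ᶠ w ∈ {w : IsDedekindDomain.HeightOneSpectrum (NumberField.RingOfIntegers K) | w.under (NumberField.RingOfIntegers F) = v}, (Polynomial.X ^ w.asIdeal.inertiaDeg (NumberField.RingOfIntegers F) - Polynomial.C (ι.symm (θ.valueAtUniformizer w)⁻¹)))) → (∀ᶠ v in Filter.cofinite, ρ.IsUnramifiedAt v) → (∃ 𝒰 : Literature.NumberTheory.Automorphic.BigHeckeGLn.TameLevel 2 F p, 𝒰.IsMaximalAbove ∧ 𝒰.IsIwahoriPadicallyAutomorphic ρ) → 2 ≤ k → 0 < m → (∀ v : IsDedekindDomain.HeightOneSpectrum (NumberField.RingOfIntegers F), (p : NumberField.RingOfIntegers F) ∈ v.asIdeal → ρ.IsOrdinaryOfWeightAt p v k m) → ∃ 𝒰 : Literature.NumberTheory.Automorphic.BigHeckeGLn.TameLevel 2 F p, 𝒰.IsMaximalAbove ∧ ∃ y : Literature.NumberTheory.Automorphic.HidaHeckeAlgebraGLn 𝒰 →+* PadicAlgCl p, Continuous y ∧ 𝒰.IsHidaAssociated y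 ρ ∧ (∀ v : IsDedekindDomain.HeightOneSpectrum (NumberField.RingOfIntegers F), (p : NumberField.RingOfIntegers F) ∈ v.asIdeal → 𝒰.IsSlopeZeroAt y v) := by
  sorry

/-- **Stub (S3) — dominant companion** (EXISTENTIAL form; the universal form is refuted modulo `NonzeroSlotZeroWeightPoint`,
`Theorems/ProModularOrdinaryClassical/Negative/SlotZeroWeight.lean`, and is NOT asserted): a continuous slope-zero point associated
with an irreducible Galois-ordinary `ρ` of parallel weight `(k, m)` at a level maximal above `p` can be traded for one (possibly at
another such level) whose slot-`0` diamond character has finite order on the global units prime to `p`. Paper: by the KNOWN direction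
of ordinary local–global compatibility (Hecke ⇒ Galois: Caraiani–Newton 2023 Thm. 4.2.15 / AHTW2026 where available) the diamond
weights of `y` are those of `ρ|I_v` in the order of the `U_v`-stable filtration, so `y` is already dominant unless `ρ|Γ_{F_v}` SPLITS,
where the dominant refinement is the companion point (Hida; Breuil–Emerton Astérisque 331 Thm. 1.1.3 over `ℚ`). Lead c3 (OPEN-CORE-c3 §1)
judged (S3) "not separable in-tree" from (S2); it is separated here because its tools (the known direction) differ. Size: L–XL. -/
theorem stub_dominantCompanion :
    ∀ (F : Type) [Field F] [NumberField F], NumberField.IsTotallyComplex F → Module.finrank ℚ F = 2 → ∀ (p : ℕ) [Fact p.Prime], p ≠ 2 → ∀ (ρ : Literature.NumberTheory.GaloisRepresentations.FramedGaloisRep F (PadicAlgCl p) 2) (𝒰 : Literature.NumberTheory.Automorphic.BigHeckeGLn.TameLevel 2 F p) (y : Literature.NumberTheory.Automorphic.HidaHeckeAlgebraGLn 𝒰 →+* PadicAlgCl p) (k m : ℕ), ρ.toGaloisRep.IsIrreducible → 𝒰.IsMaximalAbove → Continuous y → 𝒰.IsHidaAssociated y ρ → (∀ v : IsDedekindDomain.HeightOneSpectrum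 (NumberField.RingOfIntegers F), (p : NumberField.RingOfIntegers F) ∈ v.asIdeal → 𝒰.IsSlopeZeroAt y v) → 2 ≤ k → 0 < m → (∀ v : IsDedekindDomain.HeightOneSpectrum (NumberField.RingOfIntegers F), (p : NumberField.RingOfIntegers F) ∈ v.asIdeal → ρ.IsOrdinaryOfWeightAt p v k m) → ∃ 𝒰' : Literature.NumberTheory.Automorphic.BigHeckeGLn.TameLevel 2 F p, 𝒰'.IsMaximalAbove ∧ ∃ y' : Literature.NumberTheory.Automorphic.HidaHeckeAlgebraGLn 𝒰' →+* PadicAlgCl p, Continuous y' ∧ 𝒰'.IsHidaAssociated y' ρ ∧ (∀ v : IsDedekindDomain.HeightOneSpectrum (NumberField.RingOfIntegers F), (p : NumberField.RingOfIntegers F) ∈ v.asIdeal → 𝒰'.IsSlopeZeroAt y' v) ∧ ∃ N : ℕ, 0 < N ∧ ∀ (u : NumberField.RingOfIntegers F) (û : ∀ v : IsDedekindDomain.HeightOneSpectrum (NumberField.RingOfIntegers F), (p : NumberField.RingOfIntegers F) ∈ v.asIdeal → (v.adicCompletionIntegers F)ˣ), (∀ (v : IsDedekindDomain.HeightOneSpectrum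 (NumberField.RingOfIntegers F)) (hv : (p : NumberField.RingOfIntegers F) ∈ v.asIdeal), ((û v hv : v.adicCompletionIntegers F) : v.adicCompletion F) = algebraMap F (v.adicCompletion F) (u : F)) → (∏ᶠ v : {v : IsDedekindDomain.HeightOneSpectrum (NumberField.RingOfIntegers F) // (p : NumberField.RingOfIntegers F) ∈ v.asIdeal}, y' (𝒰'.hidaDiamond v.2 (Pi.mulSingle (0 : Fin 2) (û v.1 v.2)))) ^ N = 1 := by
  sorry

/-- **The child from its three stubs** (real proof: compose (S1) → (S2) → (S3)). [folklore] -/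
theorem OrdinaryFactorisationIwahoriNonCM_of :
    (∀ (F : Type) [Field F] [NumberField F] (p : ℕ) [Fact p.Prime] (ρ : Literature.NumberTheory.GaloisRepresentations.FramedGaloisRep F (PadicAlgCl p) 2), (∃ 𝒰 : Literature.NumberTheory.Automorphic.BigHeckeGLn.TameLevel 2 F p, 𝒰.IsPadicallyAutomorphic ρ) → ∃ 𝒰 : Literature.NumberTheory.Automorphic.BigHeckeGLn.TameLevel 2 F p, 𝒰.IsMaximalAbove ∧ 𝒰.IsIwahoriPadicallyAutomorphic ρ) →
    (∀ (F : Type) [Field F] [NumberField F], NumberField.IsTotallyComplex F → Module.finrank ℚ F = 2 → ∀ (p : ℕ) [Fact p.Prime], p ≠ 2 → ∀ (ι : PadicAlgCl p ≃+* ℂ) (ρ : Literature.NumberTheory.GaloisRepresentations.FramedGaloisRep F (PadicAlgCl p) 2) (k m : ℕ), ρ.toGaloisRep.IsIrreducible → (¬ ∃ (K : Type) (_ : Field K) (_ : NumberField K) (_ : Algebra F K) (_ : Module.finrank F K = 2) (θ : Literature.NumberTheory.GaloisRepresentations.HeckeCharacter K), θ.IsAlgebraic ∧ (∃ᶠ w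 : IsDedekindDomain.HeightOneSpectrum (NumberField.RingOfIntegers K) in Filter.cofinite, ∃ w' : IsDedekindDomain.HeightOneSpectrum (NumberField.RingOfIntegers K), w'.asIdeal.under (NumberField.RingOfIntegers F) = w.asIdeal.under (NumberField.RingOfIntegers F) ∧ θ.valueAtUniformizer w' ≠ θ.valueAtUniformizer w) ∧ ∀ᶠ v : IsDedekindDomain.HeightOneSpectrum (NumberField.RingOfIntegers F) in Filter.cofinite, ρ.IsUnramifiedAt v ∧ ρ.HasFrobCharpolyAt v (∏ᶠ w ∈ {w : IsDedekindDomain.HeightOneSpectrum (NumberField.RingOfIntegers K) | w.under (NumberField.RingOfIntegers F) = v}, (Polynomial.X ^ w.asIdeal.inertiaDeg (NumberField.RingOfIntegers F) - Polynomial.C (ι.symm (θ.valueAtUniformizer w)⁻¹)))) → (∀ᶠ v in Filter.cofinite, ρ.IsUnramifiedAt v) → (∃ 𝒰 : Literature.NumberTheory.Automorphic.BigHeckeGLn.TameLevel 2 F p, 𝒰.IsMaximalAbove ∧ 𝒰.IsIwahoriPadicallyAutomorphic ρ) → 2 ≤ k → 0 < m → (∀ v : IsDedekindDomain.HeightOneSpectrum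 (NumberField.RingOfIntegers F), (p : NumberField.RingOfIntegers F) ∈ v.asIdeal → ρ.IsOrdinaryOfWeightAt p v k m) → ∃ 𝒰 : Literature.NumberTheory.Automorphic.BigHeckeGLn.TameLevel 2 F p, 𝒰.IsMaximalAbove ∧ ∃ y : Literature.NumberTheory.Automorphic.HidaHeckeAlgebraGLn 𝒰 →+* PadicAlgCl p, Continuous y ∧ 𝒰.IsHidaAssociated y ρ ∧ (∀ v : IsDedekindDomain.HeightOneSpectrum (NumberField.RingOfIntegers F), (p : NumberField.RingOfIntegers F) ∈ v.asIdeal → 𝒰.IsSlopeZeroAt y v)) →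
    (∀ (F : Type) [Field F] [NumberField F], NumberField.IsTotallyComplex F → Module.finrank ℚ F = 2 → ∀ (p : ℕ) [Fact p.Prime], p ≠ 2 → ∀ (ρ : Literature.NumberTheory.GaloisRepresentations.FramedGaloisRep F (PadicAlgCl p) 2) (𝒰 : Literature.NumberTheory.Automorphic.BigHeckeGLn.TameLevel 2 F p) (y : Literature.NumberTheory.Automorphic.HidaHeckeAlgebraGLn 𝒰 →+* PadicAlgCl p) (k m : ℕ), ρ.toGaloisRep.IsIrreducible → 𝒰.IsMaximalAbove → Continuous y → 𝒰.IsHidaAssociated y ρ → (∀ v : IsDedekindDomain.HeightOneSpectrum (NumberField.RingOfIntegers F), (p : NumberField.RingOfIntegers F) ∈ v.asIdeal → 𝒰.IsSlopeZeroAt y v) → 2 ≤ k → 0 < m → (∀ v : IsDedekindDomain.HeightOneSpectrum (NumberField.RingOfIntegers F), (p : NumberField.RingOfIntegers F) ∈ v.asIdeal → ρ.IsOrdinaryOfWeightAt p v k m) → ∃ 𝒰' : Literature.NumberTheory.Automorphic.BigHeckeGLn.TameLevel 2 F p, 𝒰'.IsMaximalAbove ∧ ∃ y' : Literature.NumberTheory.Automorphic.HidaHeckeAlgebraGLn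 𝒰' →+* PadicAlgCl p, Continuous y' ∧ 𝒰'.IsHidaAssociated y' ρ ∧ (∀ v : IsDedekindDomain.HeightOneSpectrum (NumberField.RingOfIntegers F), (p : NumberField.RingOfIntegers F) ∈ v.asIdeal → 𝒰'.IsSlopeZeroAt y' v) ∧ ∃ N : ℕ, 0 < N ∧ ∀ (u : NumberField.RingOfIntegers F) (û : ∀ v : IsDedekindDomain.HeightOneSpectrum (NumberField.RingOfIntegers F), (p : NumberField.RingOfIntegers F) ∈ v.asIdeal → (v.adicCompletionIntegers F)ˣ), (∀ (v : IsDedekindDomain.HeightOneSpectrum (NumberField.RingOfIntegers F)) (hv : (p : NumberField.RingOfIntegers F) ∈ v.asIdeal), ((û v hv : v.adicCompletionIntegers F) : v.adicCompletion F) = algebraMap F (v.adicCompletion F) (u : F)) → (∏ᶠ v : {v : IsDedekindDomain.HeightOneSpectrum (NumberField.RingOfIntegers F) // (p : NumberField.RingOfIntegers F) ∈ v.asIdeal}, y' (𝒰'.hidaDiamond v.2 (Pi.mulSingle (0 : Fin 2) (û v.1 v.2)))) ^ N = 1) →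
    (∀ (F : Type) [Field F] [NumberField F], NumberField.IsTotallyComplex F → Module.finrank ℚ F = 2 → ∀ (p : ℕ) [Fact p.Prime], p ≠ 2 → ∀ (ι : PadicAlgCl p ≃+* ℂ) (ρ : Literature.NumberTheory.GaloisRepresentations.FramedGaloisRep F (PadicAlgCl p) 2) (k m : ℕ), ρ.toGaloisRep.IsIrreducible → (¬ ∃ (K : Type) (_ : Field K) (_ : NumberField K) (_ : Algebra F K) (_ : Module.finrank F K = 2) (θ : Literature.NumberTheory.GaloisRepresentations.HeckeCharacter K), θ.IsAlgebraic ∧ (∃ᶠ w : IsDedekindDomain.HeightOneSpectrum (NumberField.RingOfIntegers K) in Filter.cofinite, ∃ w' : IsDedekindDomain.HeightOneSpectrum (NumberField.RingOfIntegers K), w'.asIdeal.under (NumberField.RingOfIntegers F) = w.asIdeal.under (NumberField.RingOfIntegers F) ∧ θ.valueAtUniformizer w' ≠ θ.valueAtUniformizer w) ∧ ∀ᶠ v : IsDedekindDomain.HeightOneSpectrum (NumberField.RingOfIntegers F) in Filter.cofinite, ρ.IsUnramifiedAt v ∧ ρ.HasFrobCharpolyAt v (∏ᶠ w ∈ {w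 : IsDedekindDomain.HeightOneSpectrum (NumberField.RingOfIntegers K) | w.under (NumberField.RingOfIntegers F) = v}, (Polynomial.X ^ w.asIdeal.inertiaDeg (NumberField.RingOfIntegers F) - Polynomial.C (ι.symm (θ.valueAtUniformizer w)⁻¹)))) → (∀ᶠ v in Filter.cofinite, ρ.IsUnramifiedAt v) → (∃ 𝒰 : Literature.NumberTheory.Automorphic.BigHeckeGLn.TameLevel 2 F p, 𝒰.IsPadicallyAutomorphic ρ) → 2 ≤ k → 0 < m → (∀ v : IsDedekindDomain.HeightOneSpectrum (NumberField.RingOfIntegers F), (p : NumberField.RingOfIntegers F) ∈ v.asIdeal → ρ.IsOrdinaryOfWeightAt p v k m) → ∃ 𝒰 : Literature.NumberTheory.Automorphic.BigHeckeGLn.TameLevel 2 F p, 𝒰.IsMaximalAbove ∧ ∃ y : Literature.NumberTheory.Automorphic.HidaHeckeAlgebraGLn 𝒰 →+* PadicAlgCl p, Continuous y ∧ 𝒰.IsHidaAssociated y ρ ∧ (∀ v : IsDedekindDomain.HeightOneSpectrum (NumberField.RingOfIntegers F), (p : NumberField.RingOfIntegers F) ∈ v.asIdeal → 𝒰.IsSlopeZeroAt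 y v) ∧ ∃ N : ℕ, 0 < N ∧ ∀ (u : NumberField.RingOfIntegers F) (û : ∀ v : IsDedekindDomain.HeightOneSpectrum (NumberField.RingOfIntegers F), (p : NumberField.RingOfIntegers F) ∈ v.asIdeal → (v.adicCompletionIntegers F)ˣ), (∀ (v : IsDedekindDomain.HeightOneSpectrum (NumberField.RingOfIntegers F)) (hv : (p : NumberField.RingOfIntegers F) ∈ v.asIdeal), ((û v hv : v.adicCompletionIntegers F) : v.adicCompletion F) = algebraMap F (v.adicCompletion F) (u : F)) → (∏ᶠ v : {v : IsDedekindDomain.HeightOneSpectrum (NumberField.RingOfIntegers F) // (p : NumberField.RingOfIntegers F) ∈ v.asIdeal}, y (𝒰.hidaDiamond v.2 (Pi.mulSingle (0 : Fin 2) (û v.1 v.2)))) ^ N = 1) := by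
  intro hT hR hD F _ _ hF hdeg p _ hp ι ρ k m hirr hcm hunr hpm hk hm hv
  obtain ⟨𝒰₁, h𝒰₁, hIw⟩ := hT F p ρ hpm
  obtain ⟨𝒰, h𝒰, y, hy, hass, hslope⟩ := hR F hF hdeg p hp ι ρ k m hirr hcm hunr ⟨𝒰₁, h𝒰₁, hIw⟩ hk hm hv
  exact hD F hF hdeg p hp ρ 𝒰 y k m hirr h𝒰 hy hass hslope hk hm hv

/-- Sanity: the composition applied to the stubs concludes the child (sorries only inside `stub_*`). [folklore] -/
theorem OrdinaryFactorisationIwahoriNonCM_birth :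
    ∀ (F : Type) [Field F] [NumberField F], NumberField.IsTotallyComplex F → Module.finrank ℚ F = 2 → ∀ (p : ℕ) [Fact p.Prime], p ≠ 2 → ∀ (ι : PadicAlgCl p ≃+* ℂ) (ρ : Literature.NumberTheory.GaloisRepresentations.FramedGaloisRep F (PadicAlgCl p) 2) (k m : ℕ), ρ.toGaloisRep.IsIrreducible → (¬ ∃ (K : Type) (_ : Field K) (_ : NumberField K) (_ : Algebra F K) (_ : Module.finrank F K = 2) (θ : Literature.NumberTheory.GaloisRepresentations.HeckeCharacter K), θ.IsAlgebraic ∧ (∃ᶠ w : IsDedekindDomain.HeightOneSpectrum (NumberField.RingOfIntegers K) in Filter.cofinite, ∃ w' : IsDedekindDomain.HeightOneSpectrum (NumberField.RingOfIntegers K), w'.asIdeal.under (NumberField.RingOfIntegers F) = w.asIdeal.under (NumberField.RingOfIntegers F) ∧ θ.valueAtUniformizer w' ≠ θ.valueAtUniformizer w) ∧ ∀ᶠ v : IsDedekindDomain.HeightOneSpectrum (NumberField.RingOfIntegers F) in Filter.cofinite, ρ.IsUnramifiedAt v ∧ ρ.HasFrobCharpolyAt v (∏ᶠ w ∈ {w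 : IsDedekindDomain.HeightOneSpectrum (NumberField.RingOfIntegers K) | w.under (NumberField.RingOfIntegers F) = v}, (Polynomial.X ^ w.asIdeal.inertiaDeg (NumberField.RingOfIntegers F) - Polynomial.C (ι.symm (θ.valueAtUniformizer w)⁻¹)))) → (∀ᶠ v in Filter.cofinite, ρ.IsUnramifiedAt v) → (∃ 𝒰 : Literature.NumberTheory.Automorphic.BigHeckeGLn.TameLevel 2 F p, 𝒰.IsPadicallyAutomorphic ρ) → 2 ≤ k → 0 < m → (∀ v : IsDedekindDomain.HeightOneSpectrum (NumberField.RingOfIntegers F), (p : NumberField.RingOfIntegers F) ∈ v.asIdeal → ρ.IsOrdinaryOfWeightAt p v k m) → ∃ 𝒰 : Literature.NumberTheory.Automorphic.BigHeckeGLn.TameLevel 2 F p, 𝒰.IsMaximalAbove ∧ ∃ y : Literature.NumberTheory.Automorphic.HidaHeckeAlgebraGLn 𝒰 →+* PadicAlgCl p, Continuous y ∧ 𝒰.IsHidaAssociated y ρ ∧ (∀ v : IsDedekindDomain.HeightOneSpectrum (NumberField.RingOfIntegers F), (p : NumberField.RingOfIntegers F) ∈ v.asIdeal → 𝒰.IsSlopeZeroAt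 y v) ∧ ∃ N : ℕ, 0 < N ∧ ∀ (u : NumberField.RingOfIntegers F) (û : ∀ v : IsDedekindDomain.HeightOneSpectrum (NumberField.RingOfIntegers F), (p : NumberField.RingOfIntegers F) ∈ v.asIdeal → (v.adicCompletionIntegers F)ˣ), (∀ (v : IsDedekindDomain.HeightOneSpectrum (NumberField.RingOfIntegers F)) (hv : (p : NumberField.RingOfIntegers F) ∈ v.asIdeal), ((û v hv : v.adicCompletionIntegers F) : v.adicCompletion F) = algebraMap F (v.adicCompletion F) (u : F)) → (∏ᶠ v : {v : IsDedekindDomain.HeightOneSpectrum (NumberField.RingOfIntegers F) // (p : NumberField.RingOfIntegers F) ∈ v.asIdeal}, y (𝒰.hidaDiamond v.2 (Pi.mulSingle (0 : Fin 2) (û v.1 v.2)))) ^ N = 1 :=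
  OrdinaryFactorisationIwahoriNonCM_of stub_towerChange stub_slopeZeroRefinement stub_dominantCompanion

end Summit.Langlands.Langlands.Cruxes.OrdinaryFactorisationIwahoriNonCM.Birth

end
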